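import Literature.AlgebraicGeometry.Motives.HodgeStructurePontryaginInteriorProduct
import HarnessLib

/-!
# The Pontryagin product with a `1`-cycle is the interior product by its homology class: `c ⋆ x = i(ℓ_c) x` for `c ∈ H^{2g−1}(X)`,
# `ℓ_c = θ(c)|_{H¹} ∈ H_1 = W^∨` (`x ⋆ c = (−1)^p i(ℓ_c) x` on `H^p`), through the antiderivation rule
# `i(φ)(z ∧ x) = i(φ)z ∧ x + (−1)^q z ∧ i(φ)x` and `θ(c) = λ_{ℓ_c} = Φ(ℓ_c)`

[topic AlgebraicGeometry/Motives]

Layer `Literature/AlgebraicGeometry/Motives`, lane `lit-hodgefound` (Track 2 foundations library; prover seat `lit-hodgefound-p34`,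
generation 36, row g36-#11). THEOREMS ONLY (no definition, no named fact, no instance, no notation; net debt `0`). Sequel of rows g36-#7
(`λ_ℓ ⋆ Ψ = Ψ ∘ i(ℓ)`: "Pontryagin product with a 1-cycle is the transpose of the interior product"), g35-#2/#5 (`⋆`, PROP. 2.5.13
`θ(x ⋆ y) = (−1)^{pq} θ(x) ⋆ θ(y)` for `θ(x) = τ(· ∧ x)`, `λ_ℓ = dualOne ℓ = Φ(ℓ)`) and g29-#1 (`ann = i(·)`, `i(φ)(v ∧ x) = φ(v) x − v ∧ i(φ)x`,
`i(φ)` lowers the degree, `⋀^{>2g} W = 0`).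

THE STATEMENT IN COHOMOLOGY. Row g36-#7 identified, on HOMOLOGY `H_• = (⋀W)^∨`, the Pontryagin product with a `1`-cycle `λ_ℓ` (`ℓ ∈ H_1 = W^∨`)
as the transpose of the interior product `i(ℓ)`. Here the same fact is brought back to COHOMOLOGY `H• = ⋀W` through Poincaré duality
`θ`: a class `c ∈ H^{2g−1}(X) = ⋀^{2g−1}W` (a curve class) has `θ(c) = λ_{ℓ_c}` for the linear form `ℓ_c(w) = τ(w ∧ c)` (§2), and for
every `x`: **`c ⋆ x = i(ℓ_c)(x)`** (§3), `x ⋆ c = (−1)^p i(ℓ_c)(x)` for `x ∈ ⋀ᵖW` — the cohomological Pontryagin product with a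
`1`-cycle is the interior multiplication (cap product) by its homology class `ℓ_c = Φ⁻¹θ(c) ∈ H_1`. The proof pairs with `z ∈ ⋀^q W`:
`τ(z ∧ (c ⋆ x)) = (−1)^{(2g−1)p} (λ_{ℓ_c} ⋆ θ(x))(z) = (−1)^p τ(i(ℓ_c)z ∧ x)` (Prop. 2.5.13, row g36-#7), and `τ(i(ℓ)z ∧ x) = −(−1)^q τ(z ∧ i(ℓ)x)`
whenever `q + p = 2g + 1` by the ANTIDERIVATION RULE `i(φ)(z ∧ x) = i(φ)z ∧ x + (−1)^q z ∧ i(φ)x` (§1, `z ∈ ⋀^q`) applied to `z ∧ x ∈ ⋀^{2g+1}W = 0`;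
the signs cancel (`p + q = 2g + 1`), the other degrees pair to zero, and `τ(· ∧ ·)` is perfect.

## Sources, VERBATIM where quoted

N. Bourbaki, *Algebra I* [BourbakiAlgebraI1989], Ch. III §10 no. 2 Example 4 / §11 no. 9 (for `x* ∈ M*`, `i(x*)` is the antiderivation of
degree `−1` of `⋀(M)` extending `x*`; interior products as transposes of exterior multiplication). H. Lange, *Abelian Varieties over the
Complex Numbers* (2023) [Lange2023AbelianVarietiesComplex], §2.5.3 (p0133–p0134): Lemma 2.5.12 ("the canonical isomorphism `⋀^p H_1(X, ℤ) →
H_p(X, ℤ)` […] is given by the Pontryagin product"), Prop. 2.5.13 ("the Pontryagin product `⋆` and the map `μ^*` are dual to each other"),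
Lemma 2.5.14 ("`P(λ_I) = (−1)^{g+p} ε(I) dx_{I°}`" — Poincaré duality in the bases `{λ_I}`, `{dx_I}`); §1.1 Exercise 1.1.6 (11) (p0028).

## What is proved (all `theorem`s)

* §1 **`ann_mul_of_mem`: `i(φ)(z ∧ x) = i(φ)z ∧ x + (−1)^q z ∧ i(φ)x` for `z ∈ ⋀^q W`** (the antiderivation rule, not previously in the tree
  beyond the generator case `ann_apply_ι_mul`), and `IsSymplectic.ann_mul_eq_neg_smul_of_lt`: `i(φ)z ∧ x = −(−1)^q z ∧ i(φ)x` when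
  `deg z + deg x > 2g`.
* §2 `trace_comp_mulRight_eq_dualOne`: `θ(c) = λ_{ℓ_c}`, `ℓ_c = θ(c) ∘ ι = τ(ι(·) ∧ c)`, for `c ∈ ⋀^m W`, `m + 1 = 2g`;
  `trace_comp_mulRight_eq_pontryaginMap_ι` (`θ(c) = Φ(ℓ_c)`).
* §3 **`IsSymplectic.pontryagin_eq_ann_apply`: `c ⋆ x = i(ℓ_c) x` for every `x`**, and `IsSymplectic.pontryagin_apply_eq_smul_ann_of_mem`:
  `x ⋆ c = (−1)^p i(ℓ_c) x` for `x ∈ ⋀ᵖW`.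

TWIN NOTICE (RULING 29 bis): nothing of the torus-forms carriers is imported or restated.

## References

* [BourbakiAlgebraI1989] N. Bourbaki, *Algebra I*, Ch. III §10 no. 2 Ex. 4, §11 no. 9.
* [Lange2023AbelianVarietiesComplex] H. Lange, *Abelian Varieties over the Complex Numbers* (2023), §2.5.3 Lemma 2.5.12, Prop. 2.5.13,
  Lemma 2.5.14 (p0133–p0134); §1.1 Exercise 1.1.6 (11) (p0028).
-/

noncomputable section

open scoped TensorProduct

namespace Literature.AlgebraicGeometry.Motives

namespace ExteriorLefschetz

open ExteriorAlgebra

variable {K : Type*} [Field K] {W : Type*} [AddCommGroup W] [Module K W] {ω : ExteriorAlgebra K W} {g : ℕ}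

/-! ## §1 The antiderivation rule for `i(φ)` -/

/-- **`i(φ)(z ∧ x) = i(φ)z ∧ x + (−1)^q z ∧ i(φ)x` for `z ∈ ⋀^q W`**: the interior product by a linear form is an antiderivation of
degree `−1` (induction on `q` from `i(φ)(v ∧ y) = φ(v) y − v ∧ i(φ)y`). [cite: BourbakiAlgebraI1989, Ch. III §10 no. 2 Example 4 and §11 no. 9] -/
theorem ann_mul_of_mem (φ : Module.Dual K W) {q : ℕ} {z : ExteriorAlgebra K W} (hz : z ∈ ⋀[K]^q W) (x : ExteriorAlgebra K W) :
    ann K W φ (z * x) = ann K W φ z * x + (-1 : K) ^ q • (z * ann K W φ x) := by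
  induction hz using Submodule.pow_induction_on_left' with
  | algebraMap r =>
    rw [← Algebra.smul_def, ← Algebra.smul_def, map_smul, ann_apply_algebraMap, zero_mul, zero_add, pow_zero, one_smul]
  | add z z' i hz hz' ih ih' => rw [add_mul, map_add, ih, ih', map_add, add_mul, add_mul, smul_add, add_add_add_comm]
  | mem_mul m hm i z hz ih =>
    obtain ⟨v, rfl⟩ := LinearMap.mem_range.mp hm
    rw [mul_assoc, ann_apply_ι_mul, ih, ann_apply_ι_mul, pow_succ, mul_neg_one, neg_smul, sub_mul, smul_mul_assoc, mul_assoc, mul_add,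
      mul_smul_comm, mul_assoc]
    abel

/-- **`i(φ)z ∧ x = −(−1)^q z ∧ i(φ)x` when `deg z + deg x > 2g = dim W`** (`z ∧ x ∈ ⋀^{>2g}W = 0` in the antiderivation rule).
[cite: BourbakiAlgebraI1989, Ch. III §11 no. 9 and §7 no. 3 Prop. 6] -/
theorem IsSymplectic.ann_mul_eq_neg_smul_of_lt (hω : IsSymplectic ω g) (φ : Module.Dual K W) {q p : ℕ} {z x : ExteriorAlgebra K W}
    (hz : z ∈ ⋀[K]^q W) (hx : x ∈ ⋀[K]^p W) (h : 2 * g < q + p) :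
    ann K W φ z * x = -((-1 : K) ^ q • (z * ann K W φ x)) := by
  have h0 : z * x = 0 := by
    have hzx : z * x ∈ ⋀[K]^(q + p) W := SetLike.mul_mem_graded hz hx
    rwa [hω.exteriorPower_eq_bot h, Submodule.mem_bot] at hzx
  have key := ann_mul_of_mem φ hz x
  rw [h0, map_zero] at key
  exact eq_neg_of_add_eq_zero_left key.symm

variable [CharZero K]

/-! ## §2 `θ(c) = λ_{ℓ_c}` for `c ∈ H^{2g−1}` -/

/-- **`θ(c) = λ_{ℓ_c}` for a curve class `c ∈ ⋀^{2g−1}W`**, `ℓ_c = τ(ι(·) ∧ c) ∈ W^∨ = H_1`: `τ(z ∧ c)` vanishes off `z ∈ ⋀¹W = W` by degree, and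
`λ_ℓ = ℓ ∘ π_1`. [cite: Lange2023AbelianVarietiesComplex, §2.5.3 Lemma 2.5.14 (p0134) and Lemma 2.5.12 (p0133)] -/
theorem trace_comp_mulRight_eq_dualOne {m : ℕ} {c : ExteriorAlgebra K W} (hc : c ∈ ⋀[K]^m W) (hm : m + 1 = 2 * g) :
    trace ω g ∘ₗ LinearMap.mulRight K c = dualOne K W (trace ω g ∘ₗ LinearMap.mulRight K c ∘ₗ ι K) := by
  refine LinearMap.ext fun z ↦ ?_
  rw [LinearMap.comp_apply, LinearMap.mulRight_apply]
  induction z using DirectSum.Decomposition.inductionOn (fun i : ℕ ↦ ⋀[K]^i W) with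
  | zero => rw [zero_mul, map_zero, map_zero]
  | add z z' hz hz' => rw [add_mul, map_add, map_add, hz, hz']
  | @homogeneous q z =>
    by_cases hq : q = 1
    · subst hq
      have hz1 : (z : ExteriorAlgebra K W) ∈ LinearMap.range (ι K) ^ 1 := z.2
      rw [pow_one] at hz1
      obtain ⟨w, hw⟩ := LinearMap.mem_range.mp hz1
      rw [← hw, dualOne_ι, LinearMap.comp_apply, LinearMap.comp_apply, LinearMap.mulRight_apply]
    · rw [trace_apply_of_mem_ne (SetLike.mul_mem_graded z.2 hc) (by omega : q + m ≠ 2 * g), dualOne_apply, GradedAlgebra.proj_apply,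
        DirectSum.decompose_of_mem_ne (fun i : ℕ ↦ ⋀[K]^i W) z.2 hq, map_zero, map_zero]

/-- **`θ(c) = Φ(ℓ_c)`**: the Poincaré dual of a curve class is the `1`-cycle `Φ(ℓ_c)`, `ℓ_c = τ(ι(·) ∧ c) ∈ H_1 = W^∨`.
[cite: Lange2023AbelianVarietiesComplex, §2.5.3 Lemma 2.5.12 and Lemma 2.5.14 (p0133–p0134)] -/
theorem trace_comp_mulRight_eq_pontryaginMap_ι {m : ℕ} {c : ExteriorAlgebra K W} (hc : c ∈ ⋀[K]^m W) (hm : m + 1 = 2 * g) :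
    trace ω g ∘ₗ LinearMap.mulRight K c = pontryaginMap K W (ι K (trace ω g ∘ₗ LinearMap.mulRight K c ∘ₗ ι K)) := by
  rw [pontryaginMap_ι, trace_comp_mulRight_eq_dualOne hc hm]

/-! ## §3 `c ⋆ x = i(ℓ_c) x` -/

/-- **THE PONTRYAGIN PRODUCT WITH A `1`-CYCLE IS THE INTERIOR PRODUCT BY ITS HOMOLOGY CLASS: `c ⋆ x = i(ℓ_c)(x)` for every `x ∈ H•(X)`**,
`c ∈ H^{2g−1}(X) = ⋀^{2g−1}W`, `ℓ_c = τ(ι(·) ∧ c) = Φ⁻¹θ(c) ∈ H_1`. Proof: for `x ∈ ⋀ᵖ`, `z ∈ ⋀^q`: `τ(z ∧ (c ⋆ x)) = (−1)^{(2g−1)p}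
(λ_{ℓ_c} ⋆ θ(x))(z) = (−1)^{(2g−1)p} τ(i(ℓ_c)z ∧ x)` (Prop. 2.5.13, §2, row g36-#7 `λ_ℓ ⋆ Ψ = Ψ ∘ i(ℓ)`); for `p + q = 2g + 1` this is
`τ(z ∧ i(ℓ_c)x)` by §1 (the signs `(−1)^{(2g−1)p + q + 1}` cancel), for `p + q ≠ 2g + 1` both pairings vanish by degree; conclude by perfectness
of `τ(· ∧ ·)`. [cite: Lange2023AbelianVarietiesComplex, §2.5.3 Prop. 2.5.13 and Lemma 2.5.14 (p0134)] [cite: BourbakiAlgebraI1989, Ch. III §11 no. 9] -/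
theorem IsSymplectic.pontryagin_eq_ann_apply (hω : IsSymplectic ω g) (hg : 0 < g) {m : ℕ} {c : ExteriorAlgebra K W} (hc : c ∈ ⋀[K]^m W)
    (hm : m + 1 = 2 * g) (x : ExteriorAlgebra K W) :
    hω.pontryagin c x = ann K W (trace ω g ∘ₗ LinearMap.mulRight K c ∘ₗ ι K) x := by
  haveI : FiniteDimensional K W := hω.finite
  have hm2 : ¬Even m := by rw [Nat.not_even_iff_odd]; exact ⟨g - 1, by omega⟩
  induction x using DirectSum.Decomposition.inductionOn (fun i : ℕ ↦ ⋀[K]^i W) with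
  | zero => rw [map_zero, map_zero]
  | add x y hx hy => rw [map_add, map_add, hx, hy]
  | @homogeneous p x =>
    -- `θ(c ⋆ x) = (−1)^{mp} θ(x) ∘ i(ℓ_c)`
    have key := hω.trace_comp_mulRight_pontryagin_eq_dualConv hc x.2
    rw [trace_comp_mulRight_eq_dualOne hc hm, dualConv_dualOne_eq] at key
    rw [← sub_eq_zero]
    refine hω.eq_zero_of_forall_trace_mul_eq_zero' fun z ↦ ?_
    rw [mul_sub, map_sub, sub_eq_zero]
    induction z using DirectSum.Decomposition.inductionOn (fun i : ℕ ↦ ⋀[K]^i W) with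
    | zero => rw [zero_mul, zero_mul]
    | add z z' hz hz' => rw [add_mul, add_mul, map_add, map_add, hz, hz']
    | @homogeneous q z =>
      have hzk := LinearMap.congr_fun key z
      rw [LinearMap.comp_apply, LinearMap.mulRight_apply, LinearMap.smul_apply, LinearMap.comp_apply, LinearMap.comp_apply,
        LinearMap.mulRight_apply, smul_eq_mul] at hzk
      rw [hzk]
      by_cases hqp : q + p = 2 * g + 1
      · -- the signs `(−1)^{mp} · (−1)^{q+1}` cancel
        have hpq2 : (Even q ↔ ¬Even p) := by rw [Nat.even_iff, Nat.even_iff]; omega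
        have heven : Even (m * p + q + 1) := by
          rw [Nat.even_add_one, Nat.even_add, Nat.even_mul]; tauto
        have hs : (-1 : K) ^ (m * p) * (-1) ^ q = -1 := by
          have h1 : (-1 : K) ^ (m * p + q) * (-1) = 1 := by rw [← pow_succ]; exact heven.neg_one_pow
          rw [← pow_add]
          rwa [mul_neg_one, neg_eq_iff_eq_neg] at h1
        rw [hω.ann_mul_eq_neg_smul_of_lt _ z.2 x.2 (by omega), map_neg, map_smul, smul_eq_mul, mul_neg, ← mul_assoc, hs, neg_one_mul,
          neg_neg]
      · -- both pairings vanish by degree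
        have hL : trace ω g (ann K W (trace ω g ∘ₗ LinearMap.mulRight K c ∘ₗ ι K) z * (x : ExteriorAlgebra K W)) = 0 := by
          rcases Nat.eq_zero_or_pos q with hq0 | hq0
          · rw [ann_apply_eq_zero_of_mem_zero _ (hq0 ▸ z.2), zero_mul, map_zero]
          · exact trace_apply_of_mem_ne (SetLike.mul_mem_graded (ann_apply_mem _ z.2) x.2) (by omega)
        have hR : trace ω g ((z : ExteriorAlgebra K W) * ann K W (trace ω g ∘ₗ LinearMap.mulRight K c ∘ₗ ι K) x) = 0 := by
          rcases Nat.eq_zero_or_pos p with hp0 | hp0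
          · rw [ann_apply_eq_zero_of_mem_zero _ (hp0 ▸ x.2), mul_zero, map_zero]
          · exact trace_apply_of_mem_ne (SetLike.mul_mem_graded z.2 (ann_apply_mem _ x.2)) (by omega)
        rw [hL, hR, mul_zero]

/-- **`x ⋆ c = (−1)^p i(ℓ_c)(x)` for `x ∈ ⋀ᵖW`** (graded commutativity `x ⋆ c = (−1)^{p(2g−1)} c ⋆ x`, row g35-#2, and the previous theorem).
[cite: Lange2023AbelianVarietiesComplex, §2.5.3 Lemma 2.5.11 (p0133) and Prop. 2.5.13 (p0134)] [cite: BourbakiAlgebraI1989, Ch. III §11 no. 9] -/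
theorem IsSymplectic.pontryagin_apply_eq_smul_ann_of_mem (hω : IsSymplectic ω g) (hg : 0 < g) {m : ℕ} {c : ExteriorAlgebra K W}
    (hc : c ∈ ⋀[K]^m W) (hm : m + 1 = 2 * g) {p : ℕ} {x : ExteriorAlgebra K W} (hx : x ∈ ⋀[K]^p W) :
    hω.pontryagin x c = (-1 : K) ^ p • ann K W (trace ω g ∘ₗ LinearMap.mulRight K c ∘ₗ ι K) x := by
  have h1 : (-1 : K) ^ (p * m) = (-1) ^ p := by
    have hsq : (-1 : K) ^ p * (-1) ^ p = 1 := by rw [← pow_add, ← two_mul, pow_mul, neg_one_sq, one_pow]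
    have h2 : (-1 : K) ^ (p * m) * (-1) ^ p = 1 := by
      rw [← pow_add]
      refine Even.neg_one_pow ⟨p * g, ?_⟩
      calc p * m + p = p * (m + 1) := by ring
        _ = p * (2 * g) := by rw [hm]
        _ = p * g + p * g := by ring
    calc (-1 : K) ^ (p * m) = (-1) ^ (p * m) * ((-1) ^ p * (-1) ^ p) := by rw [hsq, mul_one]
      _ = (-1) ^ (p * m) * (-1) ^ p * (-1) ^ p := by rw [mul_assoc]
      _ = (-1) ^ p := by rw [h2, one_mul]
  rw [hω.pontryagin_comm_of_mem hx hc, hω.pontryagin_eq_ann_apply hg hc hm, h1]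

end ExteriorLefschetz

end Literature.AlgebraicGeometry.Motives
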